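/-
Origin: expansion seat `prover-pub-hodgecm-mc-binder-1-g12-0`, handover #57 2026-08-20T10:52:10Z md5 50f1b070c2ee (NEW additive KERNEL leaf; imports vendored only; drop-alone) (`HOME/mc/pub-hodgecm-mc-binder-1-g12/stage49/HodgeCM/Model/Binders/Real34FollandBox.lean`, md5 50f1b070c2ee, 124 lines);
landed by the gen-19 packager (p-g19) in gate run 49 as `HodgeCM/Model/Binders/Real34FollandBox.lean` (verbatim).
-/
/-
Origin: pub-hodgecm MODEL-CONSTRUCTION sub-cell (Hodge conjecture, CM-per-L package), seat mc-binder-1 gen 12, session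
prover-pub-hodgecm-mc-binder-1-g12-0, 2026-08-20.  Target in PKG: HodgeCM/Model/Binders/Real34FollandBox.lean (NEW additive leaf; imports vendored
tree modules only).  KERNEL MATHEMATICS ONLY: no `def … : Prop`, no `axiom`, no proof hole.  Consumer: the archimedean letter identity `harch` of the
row-17 socket `Gen12PinsP.Real34CensusSideT.ofCensus` (#56 `Binders/Real34Census`), ingredient (iii″) of `mc/pub-hodgecm-mc-binder-1-g12/HARCH-PLAN.md`.
-/
import Literature.NumberTheory.Weil1964.ArchFollandCompactKType
import Literature.NumberTheory.Automorphic.AdelicSchwartzBruhatDirectSum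
import Literature.Analysis.SegalBargmann.SchwartzTensorPiBargmann

/-!
# Row 17 (`real34`), archimedean letters: the box tensor of two Folland letters is the Folland letter of the sum frame

For Folland frames `e₁ : (ι₁ → K ⊗ ℝ) ≃L[ℝ] ℝ^{σ₁}`, `e₂ : (ι₂ → K ⊗ ℝ) ≃L[ℝ] ℝ^{σ₂}` of two archimedean Schwartz spaces, the SUM FRAME
`sumFrame e₁ e₂ : (ι₁ ⊕ ι₂ → K ⊗ ℝ) ≃L[ℝ] ℝ^{σ₁ ⊕ σ₂}` (coordinatewise), and

* **`archBoxTensor_follandFock`**: `follandFock e₁ F ⊠ follandFock e₂ G = follandFock (sumFrame e₁ e₂) (F(z_inl) · G(z_inr))`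

— the archimedean box tensor (`AdelicSchwartzBruhatDirectSum.archBoxTensor`) of two Fock letters is ONE Fock letter, of the product polynomial in
separate variables, for the sum frame (tree `SchwartzTensorPiBargmann.binvPi_rename_mul`: the inverse Bargmann transform is multiplicative on
separate variables).  Corollaries: `archBoxTensor` of two Folland–Hermite functions (`follandFock_zeta`), and bilinearity bookkeeping
(`archBoxTensor_follandFock_sub`: the wedge `Φ(P₀) ⊠ Ψ(Q₁) − Φ(P₁) ⊠ Ψ(Q₀)` is the Fock letter of `P₀(z_inl) Q₁(z_inr) − P₁(z_inl) Q₀(z_inr)`).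

This is ingredient (iii″) of the plan for the archimedean letter identity `harch` of row 17: the right-hand side of `harch`,
`Tinf (Z₂ e₀) (Z₃ e₁) − Tinf (Z₂ e₁) (Z₃ e₀)` with `Tinf = sR ∘ A ∘ sR' ∘ archBoxTensor` (#55 `exists_tau34_tmul`), is `sR (A (sR' (follandFock (sumFrame …)
(wedge polynomial))))` as soon as the line letters `Zₖ (proj a)` are Fock letters `follandFock e_k (P_{k,a})` of their line frames.

## References
* [Folland1989] G. B. Folland, *Harmonic Analysis in Phase Space*, Princeton UP (1989), §1.6 (1.63)–(1.68), §1.7 (1.81).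
-/

set_option autoImplicit false

noncomputable section

open NumberField NumberField.mixedEmbedding MvPolynomial
open Literature.Analysis.SegalBargmann Literature.NumberTheory.Weil1964 Literature.NumberTheory.Automorphic
open scoped Classical

namespace HodgeCM.Model

variable {K : Type} [Field K] {ι₁ ι₂ : Type} {σ₁ σ₂ : Type*}

/-! ## §1 The sum of two Folland frames -/

/-- **The sum of two Folland frames** `sumFrame e₁ e₂ : (ι₁ ⊕ ι₂ → K ⊗ ℝ) ≃L[ℝ] ℝ^{σ₁ ⊕ σ₂}`,
`x ↦ (e₁ (x ∘ inl), e₂ (x ∘ inr))` read as one function on `σ₁ ⊕ σ₂` (Mathlib `ContinuousLinearEquiv.sumPiEquivProdPi`, `prodCongr`). [folklore] -/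
def sumFrame (e₁ : (ι₁ → mixedSpace K) ≃L[ℝ] (σ₁ → ℝ)) (e₂ : (ι₂ → mixedSpace K) ≃L[ℝ] (σ₂ → ℝ)) :
    (ι₁ ⊕ ι₂ → mixedSpace K) ≃L[ℝ] (σ₁ ⊕ σ₂ → ℝ) :=
  (ContinuousLinearEquiv.sumPiEquivProdPi ℝ ι₁ ι₂ (fun _ => mixedSpace K)).trans
    ((e₁.prodCongr e₂).trans (ContinuousLinearEquiv.sumPiEquivProdPi ℝ σ₁ σ₂ (fun _ => ℝ)).symm)

/-- The `inl`-coordinates of the sum frame are the first frame's coordinates. [folklore] -/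
@[simp] theorem sumFrame_apply_inl (e₁ : (ι₁ → mixedSpace K) ≃L[ℝ] (σ₁ → ℝ)) (e₂ : (ι₂ → mixedSpace K) ≃L[ℝ] (σ₂ → ℝ))
    (x : ι₁ ⊕ ι₂ → mixedSpace K) (s : σ₁) : sumFrame e₁ e₂ x (Sum.inl s) = e₁ (fun i => x (Sum.inl i)) s := rfl

/-- The `inr`-coordinates of the sum frame are the second frame's coordinates. [folklore] -/
@[simp] theorem sumFrame_apply_inr (e₁ : (ι₁ → mixedSpace K) ≃L[ℝ] (σ₁ → ℝ)) (e₂ : (ι₂ → mixedSpace K) ≃L[ℝ] (σ₂ → ℝ))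
    (x : ι₁ ⊕ ι₂ → mixedSpace K) (s : σ₂) : sumFrame e₁ e₂ x (Sum.inr s) = e₂ (fun i => x (Sum.inr i)) s := rfl

/-- The sum frame restricted along `inl`. [folklore] -/
theorem sumFrame_comp_inl (e₁ : (ι₁ → mixedSpace K) ≃L[ℝ] (σ₁ → ℝ)) (e₂ : (ι₂ → mixedSpace K) ≃L[ℝ] (σ₂ → ℝ))
    (x : ι₁ ⊕ ι₂ → mixedSpace K) : sumFrame e₁ e₂ x ∘ Sum.inl = e₁ (x ∘ Sum.inl) := rfl

/-- The sum frame restricted along `inr`. [folklore] -/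
theorem sumFrame_comp_inr (e₁ : (ι₁ → mixedSpace K) ≃L[ℝ] (σ₁ → ℝ)) (e₂ : (ι₂ → mixedSpace K) ≃L[ℝ] (σ₂ → ℝ))
    (x : ι₁ ⊕ ι₂ → mixedSpace K) : sumFrame e₁ e₂ x ∘ Sum.inr = e₂ (x ∘ Sum.inr) := rfl

/-- The inverse of the sum frame: `(sumFrame e₁ e₂)⁻¹ y = (e₁⁻¹ (y ∘ inl), e₂⁻¹ (y ∘ inr))` glued along `inl`/`inr`. [folklore] -/
theorem sumFrame_symm_apply (e₁ : (ι₁ → mixedSpace K) ≃L[ℝ] (σ₁ → ℝ)) (e₂ : (ι₂ → mixedSpace K) ≃L[ℝ] (σ₂ → ℝ))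
    (y : σ₁ ⊕ σ₂ → ℝ) :
    (sumFrame e₁ e₂).symm y = Sum.elim (e₁.symm (fun s => y (Sum.inl s))) (e₂.symm (fun s => y (Sum.inr s))) := by
  apply (sumFrame e₁ e₂).injective
  rw [ContinuousLinearEquiv.apply_symm_apply]
  ext (s | s)
  · rw [sumFrame_apply_inl]
    simp only [Sum.elim_inl, ContinuousLinearEquiv.apply_symm_apply]
  · rw [sumFrame_apply_inr]
    simp only [Sum.elim_inr, ContinuousLinearEquiv.apply_symm_apply]

section Letters

variable [NumberField K] [Fintype ι₁] [Fintype ι₂] [Fintype σ₁] [Fintype σ₂] [DecidableEq σ₁] [DecidableEq σ₂]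

/-! ## §2 Box tensor of Folland letters -/

omit [Fintype ι₁] [Fintype ι₂] [Fintype σ₁] [Fintype σ₂] [DecidableEq σ₁] [DecidableEq σ₂] in
/-- Pointwise value of a Folland letter: `follandFock e F x = (B⁻¹ F) (e x)`. [cite: Folland1989, §1.7 (1.81)] -/
theorem follandFock_apply {ι : Type} [Fintype ι] {σ : Type*} [Fintype σ] [DecidableEq σ]
    (e : (ι → mixedSpace K) ≃L[ℝ] (σ → ℝ)) (F : MvPolynomial σ ℂ) (x : ι → mixedSpace K) :
    follandFock e F x = (binvPi F : SchwartzMap (σ → ℝ) ℂ) (e x) := rfl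

/-- **The box tensor of two Folland letters is the Folland letter of the sum frame**:
`follandFock e₁ F ⊠ follandFock e₂ G = follandFock (sumFrame e₁ e₂) (F(z_inl) · G(z_inr))`. [cite: Folland1989, §1.6 (1.63)–(1.68), §1.7 (1.81)] -/
theorem archBoxTensor_follandFock (e₁ : (ι₁ → mixedSpace K) ≃L[ℝ] (σ₁ → ℝ)) (e₂ : (ι₂ → mixedSpace K) ≃L[ℝ] (σ₂ → ℝ))
    (F : MvPolynomial σ₁ ℂ) (G : MvPolynomial σ₂ ℂ) :
    archBoxTensor (follandFock e₁ F) (follandFock e₂ G) =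
      follandFock (sumFrame e₁ e₂) (rename Sum.inl F * rename Sum.inr G) := by
  ext x
  rw [archBoxTensor_apply, follandFock_apply, follandFock_apply, follandFock_apply, binvPi_rename_mul, tensorPi_apply]
  rfl

/-- The same for two Folland–Hermite functions: `h_α^{e₁} ⊠ h_β^{e₂} = follandFock (sumFrame e₁ e₂) (ζ_α(z_inl) ζ_β(z_inr))`.
[cite: Folland1989, §1.7 (1.81)] -/
theorem archBoxTensor_follandHermite (e₁ : (ι₁ → mixedSpace K) ≃L[ℝ] (σ₁ → ℝ)) (e₂ : (ι₂ → mixedSpace K) ≃L[ℝ] (σ₂ → ℝ))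
    (α : σ₁ →₀ ℕ) (β : σ₂ →₀ ℕ) :
    archBoxTensor (follandHermite e₁ α) (follandHermite e₂ β) =
      follandFock (sumFrame e₁ e₂) (rename Sum.inl (zeta α) * rename Sum.inr (zeta β)) := by
  rw [← follandFock_zeta, ← follandFock_zeta, archBoxTensor_follandFock]

/-- **Wedge bookkeeping**: `Φ(P₀) ⊠ Ψ(Q₁) − Φ(P₁) ⊠ Ψ(Q₀)` is the Folland letter of `P₀(z_inl) Q₁(z_inr) − P₁(z_inl) Q₀(z_inr)` for the sum frame.
[cite: Folland1989, §1.7 (1.81)] -/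
theorem archBoxTensor_follandFock_sub (e₁ : (ι₁ → mixedSpace K) ≃L[ℝ] (σ₁ → ℝ)) (e₂ : (ι₂ → mixedSpace K) ≃L[ℝ] (σ₂ → ℝ))
    (P₀ P₁ : MvPolynomial σ₁ ℂ) (Q₀ Q₁ : MvPolynomial σ₂ ℂ) :
    archBoxTensor (follandFock e₁ P₀) (follandFock e₂ Q₁) - archBoxTensor (follandFock e₁ P₁) (follandFock e₂ Q₀) =
      follandFock (sumFrame e₁ e₂)
        (rename Sum.inl P₀ * rename Sum.inr Q₁ - rename Sum.inl P₁ * rename Sum.inr Q₀) := by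
  rw [archBoxTensor_follandFock, archBoxTensor_follandFock, sub_eq_iff_eq_add, ← follandFock_add, sub_add_cancel]

end Letters

end HodgeCM.Model

end
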